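import Mathlib
import Literature.Computability.AlgebraicComplexity.GroupTheoreticMatMul
import Literature.Computability.AlgebraicComplexity.LaserHashing

/-!
Sketch — first lemmas of the three crux ideas for `ThinBlockAlpha.BoundedExponentThird`
(stmt-MatrixMultiplication-10596).  Statements only (sorried); they must elaborate.
-/

open scoped Pointwise BigOperators
open Finset Literature.Computability.AlgebraicComplexity

namespace Summit.MatrixMultiplication.MatrixMultiplication.Cruxes.BoundedExponentThird.Sketch

/-- The value set of a coordinate pattern `(x, y, z)` of an `H₀`-chart, in the index threading of
the tree's `IsSTPP` (`s' ∈ A i, s ∈ A k, t ∈ B i, t' ∈ B j, u ∈ C j, u' ∈ C k`,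
relation `(s' - s) + (t' - t) + (u' - u) = 0`): the coordinate is GOOD iff `0 ∉ patternSet`. -/
def patternSet {H₀ Γ : Type} [AddCommGroup H₀] [DecidableEq H₀] (A B C : Γ → Finset H₀)
    (x y z : Γ) : Finset H₀ :=
  (A x - A z) + (B y - B x) + (C z - C y)

/-- Single-symbol triple product property of a chart symbol. -/
def SymbolTPP {H₀ : Type} [AddCommGroup H₀] (A B C : Finset H₀) : Prop :=
  ∀ a ∈ A, ∀ a' ∈ A, ∀ b ∈ B, ∀ b' ∈ B, ∀ c ∈ C, ∀ c' ∈ C,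
    (a' - a) + (b' - b) + (c' - c) = 0 → a = a' ∧ b = b' ∧ c = c'

/-- IDEA 2 (null-offset hashing charts), first lemma = CKSU 2005 Thm 37 in the tree's conventions:
a local chart-USP (every not-all-equal ordered triple of rows has a GOOD coordinate) over a chart of
TPP symbols yields an `IsSTPP` family of product blocks in `Fin n → H₀` (exponent = exponent of `H₀`). -/
theorem isSTPP_of_localChartUSP {H₀ Γ : Type} [AddCommGroup H₀] [DecidableEq H₀] [DecidableEq Γ]
    (A B C : Γ → Finset H₀) (hTPP : ∀ x, SymbolTPP (A x) (B x) (C x))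
    {n L : ℕ} (row : Fin L → Fin n → Γ)
    (husp : ∀ i j k : Fin L, ¬ (i = j ∧ j = k) →
      ∃ c : Fin n, (0 : H₀) ∉ patternSet A B C (row i c) (row j c) (row k c)) :
    IsSTPP (fun i => Fintype.piFinset fun c => A (row i c))
      (fun i => Fintype.piFinset fun c => B (row i c))
      (fun i => Fintype.piFinset fun c => C (row i c)) := by
  sorry

/-- IDEA 2, second lemma (the reduction to the tree's hashing theorem): if the BAD ordered triples of
rows are `linearly trapped` — three piece maps into `ℤ^r`, jointly injective, summing to zero on every
row, such that every bad triple `(u,v,w)` has pieces `(π₁ u, π₂ v, π₃ w)` equal to the pieces of some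
row — then every free diagonal (in the sense of `BCS1997_thm1539_free`) of the piece set is a local
chart-USP. -/
theorem localChartUSP_of_freeDiagonal {Γ : Type} [DecidableEq Γ] {n r : ℕ}
    (good : Γ → Γ → Γ → Prop) (rows : Finset (Fin n → Γ))
    (π₁ π₂ π₃ : (Fin n → Γ) → (Fin r → ℤ))
    (hinj : Set.InjOn (fun u => (π₁ u, π₂ u, π₃ u)) ↑rows)
    (htrap : ∀ u ∈ rows, ∀ v ∈ rows, ∀ w ∈ rows, (∀ c, ¬ good (u c) (v c) (w c)) →
      ∃ z ∈ rows, π₁ z = π₁ u ∧ π₂ z = π₂ v ∧ π₃ z = π₃ w)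
    (Δ : Finset (Fin n → Γ)) (hΔ : Δ ⊆ rows)
    (hfree : ∀ δ ∈ Δ, ∀ δ' ∈ Δ, ∀ δ'' ∈ Δ,
      (∃ z ∈ rows, π₁ z = π₁ δ ∧ π₂ z = π₂ δ' ∧ π₃ z = π₃ δ'') → δ = δ' ∧ δ' = δ'') :
    ∀ u ∈ Δ, ∀ v ∈ Δ, ∀ w ∈ Δ, ¬ (u = v ∧ v = w) → ∃ c, good (u c) (v c) (w c) := by
  sorry

/-- IDEA 1 (potential-certified charts), first lemma: a degeneration-order certificate on SYMBOLS —
integer potentials `f₁ + f₂ + f₃ ≡ 0` that are positive on every off-diagonal BAD pattern — makes the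
WHOLE composition class a local chart-USP, hence (Thm 37) an STPP family: summing the potentials
over the coordinates of three equal-composition rows gives `0`, so no coordinate can be off-diagonal
bad, and a triple all of whose coordinates are diagonal is `u = v = w`. -/
theorem isSTPP_of_potentials {H₀ Γ : Type} [AddCommGroup H₀] [DecidableEq H₀] [Fintype Γ]
    [DecidableEq Γ] (A B C : Γ → Finset H₀) (hTPP : ∀ x, SymbolTPP (A x) (B x) (C x))
    (f₁ f₂ f₃ : Γ → ℤ) (hsum : ∀ x, f₁ x + f₂ x + f₃ x = 0)
    (hpos : ∀ x y z : Γ, ¬ (x = y ∧ y = z) → (0 : H₀) ∈ patternSet A B C x y z →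
      0 < f₁ x + f₂ y + f₃ z)
    {n L : ℕ} (row : Fin L → Fin n → Γ) (hrow : Function.Injective row)
    (hcomp : ∀ i j : Fin L, ∀ x : Γ,
      (univ.filter fun c => row i c = x).card = (univ.filter fun c => row j c = x).card) :
    IsSTPP (fun i => Fintype.piFinset fun c => A (row i c))
      (fun i => Fintype.piFinset fun c => B (row i c))
      (fun i => Fintype.piFinset fun c => C (row i c)) := by
  sorry

/-- IDEA 3 (border STPP + weight slicing), the objects: a BORDER STPP family — separable integer
weights `p i : H → ℤ` on `A i`, `q i` on `B i`, `r i` on `C i`; every solution of the STPP relation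
has nonnegative total weight, and weight zero only on the trivial (diagonal) solutions. Honest
`IsSTPP` is the case of zero weights. -/
def IsBorderSTPP {H : Type} [AddCommGroup H] {L : ℕ} (A B C : Fin L → Finset H)
    (p q r : Fin L → H → ℤ) : Prop :=
  ∀ i j k : Fin L, ∀ s ∈ A k, ∀ s' ∈ A i, ∀ t ∈ B i, ∀ t' ∈ B j, ∀ u ∈ C j, ∀ u' ∈ C k,
    (s' - s) + (t' - t) + (u' - u) = 0 →
      0 ≤ (p i s' - p k s) + (q j t' - q i t) + (r k u' - r j u) ∧
      ((p i s' - p k s) + (q j t' - q i t) + (r k u' - r j u) = 0 →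
        i = j ∧ j = k ∧ s = s' ∧ t = t' ∧ u = u')

/-- IDEA 3, first lemma (the slicing transfer, BCCGNSU Lemma 3.4 transplanted to designs): in the
`m`-th power, index blocks by words `I : Fin m → Fin L` (any sub-family `e`), and SLICE each product
set at COMMON weight levels `(π, κ, ρ)`; the sliced family is an honest STPP in `Fin m → H`
(same exponent as `H`).  Choosing `e` = one composition class and the popular levels loses only
`(2mR+1)` per leg, i.e. `N^{o(1)}`. -/
theorem isSTPP_slice_of_isBorderSTPP {H : Type} [AddCommGroup H] [DecidableEq H] {L : ℕ}
    (A B C : Fin L → Finset H) (p q r : Fin L → H → ℤ) (hB : IsBorderSTPP A B C p q r)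
    {m K : ℕ} (e : Fin K → (Fin m → Fin L)) (he : Function.Injective e) (π κ ρ : ℤ) :
    IsSTPP
      (fun k => (Fintype.piFinset fun l => A (e k l)).filter fun s => ∑ l, p (e k l) (s l) = π)
      (fun k => (Fintype.piFinset fun l => B (e k l)).filter fun t => ∑ l, q (e k l) (t l) = κ)
      (fun k => (Fintype.piFinset fun l => C (e k l)).filter fun u => ∑ l, r (e k l) (u l) = ρ) := by
  sorry

/-- The near-miss chart of IDEA 2 over `ZMod 8` (γ = 1): symbols a, b, c, o. Recorded so that the
pattern table can be recomputed by `decide`-style evaluation downstream. -/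
def chartA (x : Fin 4) : Finset (ZMod 8) :=
  if x = 0 then (univ.filter fun h => h ≠ 0 ∧ h ≠ 1) else {0}
def chartB (x : Fin 4) : Finset (ZMod 8) :=
  if x = 1 then (univ.filter fun h => h ≠ 0 ∧ h ≠ -1) else {0}
def chartC (x : Fin 4) : Finset (ZMod 8) :=
  if x = 2 then (univ.filter fun h => h ≠ 0 ∧ h ≠ 1) else if x = 0 ∨ x = 3 then {1} else {0}

end Summit.MatrixMultiplication.MatrixMultiplication.Cruxes.BoundedExponentThird.Sketch
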